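import Mathlib
import HarnessLib
import Literature.AlgebraicGeometry.Ramification.InertiaNormalSylow
import Literature.AlgebraicGeometry.Resolution.BlowupDisjointCentreSplitting
import Literature.AlgebraicGeometry.Resolution.BlowupsEquivariant
import Summits.ResolutionOfSingularities.ResolutionOfSingularities.Theorems.WildQuotientsWildQuotientResolutionInertLocusCentre

/-!
# Orbit centres: the union of pairwise DISJOINT conjugate tame inert loci is a `G`-stable regular centre
# (crux `WildQuotients.WildQuotientResolution`, stub `stub_phaseZeroHighDim`; orbit-regularity of non-normal tame centres)

Crux stmt-ResolutionOfSingularities-15640 (`WildQuotientResolution`), registered stub `stub_phaseZeroHighDim`.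
✓`tameInertLocusCentre` / ✓`tameMove` (p819658 / p819797) need the tame subgroup `K` to be NORMAL in `G` for the
reduced inert locus `Z_K` to be `G`-stable. The centres that a Batyrev-ordered tame layer uses
(✓`NpcTameCentre` p820512: `Fix(t)` for a tame `t` of the inertia group) are not normal; their `G`-orbit is the union
`⋃_g Z_{gKg⁻¹}` of the CONJUGATE inert loci (✓`preimage_inertLocus`). This file proves the orbit-regularity
statement R-B′(ii) of the evidence memo PHASE0-TAME-CENTRE-ORDER.md in the form the blow-up theorems consume: if a
finite conjugation-stable family `S` of subgroups has PAIRWISE DISJOINT closed inert loci, each with regular reduced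
subscheme (tame members: ✓`isRegular_subscheme_vanishingIdeal_inertLocus_of_coprime`), then the reduced ideal sheaf
of `W = ⋃_{K ∈ S} Z_K` is `G`-STABLE with REGULAR subscheme, and its stalk at a point of `Z_K` is that of `𝓘_{Z_K}`
(so all the local theory — ✓`InertLocusStalk`, ✓`TameMoveEigen` — applies verbatim).

* `vanishingIdeal_finsetSup_of_pairwise_disjoint` — for pairwise disjoint closed `Zᵢ` with `V(𝓘_{Zᵢ})` regular:
  `V(𝓘_{⋃ Zᵢ})` is regular and `(𝓘_{Zᵢ})_x = (𝓘_{⋃ Zⱼ})_x` on `Zᵢ` (induction on ✓`vanishingIdeal_sup_eq_mul_of_disjoint`,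
  ✓`isRegular_subscheme_mul_of_disjoint_support`, ✓`stalkIdeal_vanishingIdeal_left/right_of_disjoint_union`);
* `preimage_biUnion_inertLocus` — a conjugation-stable family of inert loci has `G`-stable union;
* `tameOrbitCentre` — the package.

[OURS · crux stmt-ResolutionOfSingularities-15640 · helper toward `stub_phaseZeroHighDim`; folklore, counted 0;
AI-level work, weaker than expert review.] [folklore]
-/

-- single-problem summit: the doubled namespace component `ResolutionOfSingularities` is forced
set_option linter.dupNamespace false

noncomputable section

namespace Summit.ResolutionOfSingularities.ResolutionOfSingularities.Theorems.WildQuotientResolution.InertLocusStalk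

open CategoryTheory AlgebraicGeometry TopologicalSpace IsLocalRing
open Literature.AlgebraicGeometry.Resolution Literature.AlgebraicGeometry.Ramification
open Scheme.IdealSheafData

universe u

/-! ## Disjoint unions of regular reduced centres -/

section DisjointUnion

variable {X : Scheme.{u}} [IsLocallyNoetherian X]

omit [IsLocallyNoetherian X] in
/-- The reduced ideal sheaf of the empty closed set is the unit ideal sheaf. [folklore] -/
theorem vanishingIdeal_bot_eq_top : vanishingIdeal (⊥ : Closeds X) = ⊤ :=
  le_antisymm le_top (le_support_iff_le_vanishingIdeal.mp bot_le)

/-- **Pairwise disjoint regular reduced centres have a regular reduced union, with the same stalks**: for a finite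
family of pairwise disjoint closed subsets `Zᵢ` each of whose reduced subschemes `V(𝓘_{Zᵢ})` is regular, the reduced
subscheme of `⋃ᵢ Zᵢ` is regular and `(𝓘_{Zᵢ})_x = (𝓘_{⋃ Zⱼ})_x` at every `x ∈ Zᵢ`. [folklore] -/
theorem vanishingIdeal_finsetSup_of_pairwise_disjoint {ι : Type*} [DecidableEq ι] (S : Finset ι)
    (Z : ι → Closeds X) (hdisj : ∀ i ∈ S, ∀ j ∈ S, i ≠ j → Disjoint (Z i : Set X) (Z j))
    (hreg : ∀ i ∈ S, Scheme.IsRegular (vanishingIdeal (Z i)).subscheme) :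
    Scheme.IsRegular (vanishingIdeal (S.sup Z)).subscheme ∧
      ∀ i ∈ S, ∀ x ∈ (Z i : Set X), stalkIdeal (vanishingIdeal (Z i)) x = stalkIdeal (vanishingIdeal (S.sup Z)) x := by
  induction S using Finset.induction_on with
  | empty =>
    refine ⟨?_, fun i hi => absurd hi (Finset.notMem_empty i)⟩
    rw [Finset.sup_empty, vanishingIdeal_bot_eq_top]
    exact isRegular_subscheme_top
  | insert i S hiS ih =>
    have hdisjS : ∀ i ∈ S, ∀ j ∈ S, i ≠ j → Disjoint (Z i : Set X) (Z j) := fun i hi j hj hij =>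
      hdisj i (Finset.mem_insert_of_mem hi) j (Finset.mem_insert_of_mem hj) hij
    have hregS : ∀ i ∈ S, Scheme.IsRegular (vanishingIdeal (Z i)).subscheme := fun i hi =>
      hreg i (Finset.mem_insert_of_mem hi)
    obtain ⟨ihreg, ihstalk⟩ := ih hdisjS hregS
    have hcoe : ((S.sup Z : Closeds X) : Set X) = ⋃ j ∈ S, (Z j : Set X) := by
      simp only [Closeds.coe_finset_sup, Finset.sup_set_eq_biUnion, Function.comp_apply]
    -- `Z i` is disjoint from the union of the others
    have hdZ : Disjoint (Z i : Set X) ((S.sup Z : Closeds X) : Set X) := by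
      rw [hcoe, Set.disjoint_iUnion₂_right]
      intro j hj
      exact hdisj i (Finset.mem_insert_self i S) j (Finset.mem_insert_of_mem hj)
        (fun h => hiS (h ▸ hj))
    have hsup : (insert i S).sup Z = Z i ⊔ S.sup Z := Finset.sup_insert
    have hmul : vanishingIdeal ((insert i S).sup Z) = vanishingIdeal (Z i) * vanishingIdeal (S.sup Z) := by
      rw [hsup, vanishingIdeal_sup_eq_mul_of_disjoint hdZ]
    have hregC : Scheme.IsRegular (vanishingIdeal ((insert i S).sup Z)).subscheme := by
      rw [hmul]
      refine isRegular_subscheme_mul_of_disjoint_support (hreg i (Finset.mem_insert_self i S)) ihreg ?_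
      rwa [Scheme.IdealSheafData.coe_support_vanishingIdeal, Scheme.IdealSheafData.coe_support_vanishingIdeal]
    have hU : (Z i : Set X) ∪ ((S.sup Z : Closeds X) : Set X) =
        ((vanishingIdeal ((insert i S).sup Z)).support : Set X) := by
      rw [Scheme.IdealSheafData.coe_support_vanishingIdeal, hsup, Closeds.coe_sup]
    refine ⟨hregC, fun j hj x hx => ?_⟩
    rcases Finset.mem_insert.mp hj with rfl | hjS
    · exact stalkIdeal_vanishingIdeal_left_of_disjoint_union hregC hdZ hU hx
    · rw [ihstalk j hjS x hx]
      have hxT : x ∈ ((S.sup Z : Closeds X) : Set X) := by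
        rw [hcoe]
        exact Set.mem_iUnion₂.mpr ⟨j, hjS, hx⟩
      exact stalkIdeal_vanishingIdeal_right_of_disjoint_union hregC hdZ hU hxT

end DisjointUnion

/-! ## Orbit centres of tame subgroups -/

section Orbit

variable {X : Scheme.{0}} {G : Type} [Group G] (σ : G →* Aut X)

/-- **A conjugation-stable family of inert loci has `G`-stable union**: if `S` is a finite set of subgroups stable
under conjugation, `(ρ g)⁻¹ (⋃_{K ∈ S} Z_K) = ⋃_{K ∈ S} Z_K`. [folklore] -/
theorem preimage_biUnion_inertLocus (S : Finset (Subgroup G))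
    (hS : ∀ (g : G), ∀ K ∈ S, K.map (MulAut.conj g).toMonoidHom ∈ S) (g : G) :
    (σ g).hom.base ⁻¹' (⋃ K ∈ S, {y : X | K ≤ inertiaSubgroup σ y}) =
      ⋃ K ∈ S, {y : X | K ≤ inertiaSubgroup σ y} := by
  ext y
  simp only [Set.preimage_iUnion, Set.mem_iUnion, exists_prop]
  constructor
  · rintro ⟨K, hK, hy⟩
    refine ⟨K.map (MulAut.conj g⁻¹).toMonoidHom, hS g⁻¹ K hK, ?_⟩
    have h := preimage_inertLocus σ g K
    have hy' : y ∈ (σ g).hom.base ⁻¹' {y : X | K ≤ inertiaSubgroup σ y} := hy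
    rw [h] at hy'
    exact hy'
  · rintro ⟨K, hK, hy⟩
    refine ⟨K.map (MulAut.conj g).toMonoidHom, hS g K hK, ?_⟩
    change y ∈ (σ g).hom.base ⁻¹' {y : X | K.map (MulAut.conj g).toMonoidHom ≤ inertiaSubgroup σ y}
    rw [preimage_inertLocus σ g, Subgroup.map_map]
    have e : (MulAut.conj g⁻¹).toMonoidHom.comp (MulAut.conj g).toMonoidHom = MonoidHom.id G := by
      ext h
      simp [MulAut.conj_apply, mul_assoc]
    rw [e, Subgroup.map_id]
    exact hy

/-- **Orbit centres** (crux stmt-ResolutionOfSingularities-15640, toward `stub_phaseZeroHighDim`; R-B′(ii) of the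
evidence memo). Let `S` be a finite conjugation-stable family of subgroups of `G` (e.g. the conjugacy class of a tame
cyclic subgroup of an inertia group) acting on the locally Noetherian `X`, with closed inert loci `Z_K` which are
PAIRWISE DISJOINT for distinct members and whose reduced subschemes are regular (tame members with regular stalks:
✓`isRegular_subscheme_vanishingIdeal_inertLocus_of_coprime`). Then the reduced ideal sheaf `𝒥` of
`W = ⋃_{K ∈ S} Z_K` is `G`-STABLE (`𝒥.comap (ρ g) = 𝒥`), its subscheme is REGULAR, and `𝒥_x = (𝓘_{Z_K})_x` at every
`x ∈ Z_K`, `K ∈ S` — the inputs of the equivariant blow-up theorems for a NON-normal tame centre. [folklore] -/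
theorem tameOrbitCentre [IsLocallyNoetherian X] (S : Finset (Subgroup G))
    (hS : ∀ (g : G), ∀ K ∈ S, K.map (MulAut.conj g).toMonoidHom ∈ S)
    (hZ : ∀ K : Subgroup G, IsClosed {y : X | K ≤ inertiaSubgroup σ y})
    (hdisj : ∀ K ∈ S, ∀ K' ∈ S, K ≠ K' →
      Disjoint {y : X | K ≤ inertiaSubgroup σ y} {y : X | K' ≤ inertiaSubgroup σ y})
    (hreg : ∀ K ∈ S, Scheme.IsRegular
      (vanishingIdeal ⟨{y : X | K ≤ inertiaSubgroup σ y}, hZ K⟩).subscheme) :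
    ∃ hW : IsClosed (⋃ K ∈ S, {y : X | K ≤ inertiaSubgroup σ y}),
      (∀ g : G, (vanishingIdeal ⟨⋃ K ∈ S, {y : X | K ≤ inertiaSubgroup σ y}, hW⟩).comap (σ g).hom =
        vanishingIdeal ⟨⋃ K ∈ S, {y : X | K ≤ inertiaSubgroup σ y}, hW⟩) ∧
      Scheme.IsRegular (vanishingIdeal ⟨⋃ K ∈ S, {y : X | K ≤ inertiaSubgroup σ y}, hW⟩).subscheme ∧
      ∀ K ∈ S, ∀ x ∈ {y : X | K ≤ inertiaSubgroup σ y},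
        stalkIdeal (vanishingIdeal ⟨{y : X | K ≤ inertiaSubgroup σ y}, hZ K⟩) x =
          stalkIdeal (vanishingIdeal ⟨⋃ K ∈ S, {y : X | K ≤ inertiaSubgroup σ y}, hW⟩) x := by
  classical
  let Z : Subgroup G → Closeds X := fun K => ⟨{y : X | K ≤ inertiaSubgroup σ y}, hZ K⟩
  have hsupeq : ((S.sup Z : Closeds X) : Set X) = ⋃ K ∈ S, {y : X | K ≤ inertiaSubgroup σ y} := by
    simp only [Closeds.coe_finset_sup, Finset.sup_set_eq_biUnion, Function.comp_apply]
    rfl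
  have hW : IsClosed (⋃ K ∈ S, {y : X | K ≤ inertiaSubgroup σ y}) := by
    rw [← hsupeq]
    exact (S.sup Z).isClosed
  have hWeq : (⟨⋃ K ∈ S, {y : X | K ≤ inertiaSubgroup σ y}, hW⟩ : Closeds X) = S.sup Z :=
    Closeds.ext hsupeq.symm
  obtain ⟨hregW, hstalk⟩ := vanishingIdeal_finsetSup_of_pairwise_disjoint S Z
    (fun K hK K' hK' hne => hdisj K hK K' hK' hne) (fun K hK => hreg K hK)
  refine ⟨hW, fun g => ?_, ?_, fun K hK x hx => ?_⟩
  · exact vanishingIdeal_comap_eq_of_action σ ⟨_, hW⟩ (fun g => preimage_biUnion_inertLocus σ S hS g) g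
  · rw [hWeq]
    exact hregW
  · rw [hWeq]
    exact hstalk K hK x hx

end Orbit

end Summit.ResolutionOfSingularities.ResolutionOfSingularities.Theorems.WildQuotientResolution.InertLocusStalk

end
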